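import Mathlib
import Literature.Geometry.DiscreteGeometry.KissingNodeDegree
import Literature.Geometry.DiscreteGeometry.SphericalCodeContactGraph
import Summits.AtomisticToContinuum.Crystallization.Theorems.SquareWellLayerCakeAveragedTwelveLensSix
import HarnessLib

/-!
# Crux `SquareWellLayerCake.AveragedTwelve` (stmt-AtomisticToContinuum-15806), line `Sketch`
# (idea par-five-delaunay-recount), stub `stub_lensPinning` — lens capacity five for a long pair

This file is stub `stub_lensPinning` of line `Sketch` (idea par-five-delaunay-recount) of crux
`SquareWellLayerCake.AveragedTwelve` (stmt-AtomisticToContinuum-15806): the length-pinned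
sharpening of the lens lemma `ParFiveRecountLensSix.stub_lensSix` (file
`SquareWellLayerCakeAveragedTwelveLensSix.lean`, whose frame and one-point estimates are reused).

**Statement.** Let `0 < d`, `ρ ≤ (57/50) d`, and let `x, y ∈ ℝ³` be a *long* near pair,
`(113/100) d ≤ ℓ := |xy| ≤ ρ`.  If `S` is a finite `d`-separated set of points `z` with
`d ≤ |zx| ≤ ρ` and `d ≤ |zy| ≤ ρ` (the *lens* of the pair), then `|S| ≤ 5`.

**Proof.** In an orthonormal frame of `ℝ³` with third vector `n = (y − x)/ℓ`
(`ParFiveRecountLensSix.exists_frame`) write `z − x = (X, Y, H)`, `u = X² + Y² = r²` (`r ≥ 0`),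
`h = H − ℓ/2`.  One lens point satisfies `u + 5h² ≤ A := ρ² − ℓ²/4` and `u ≥ L := d² − ℓ²/4 > 0`
(`ParFiveRecountLensSix.lens_point_bounds`).  For two lens points at distance `≥ d` with planar
inner product `P` one has `2P ≤ u + u' + (h − h')² − d²` and `2 r r' = u + u' − (r − r')²`; as
`(u + u')/2 + (h − h')² ≤ A − (h² + h'²)/2 ≤ A`, `(r − r')² ≤ (u − u')² / (r + r')² ≤ (ρ² − d²)² / (4L)
≤ (7/200) d²` and `A + (7/400) d² ≤ (3249/2500 − 12769/40000 + 7/400) d² < d²` once `ℓ ≥ 1.13 d`,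
this gives the *strict* bound `2P < r r'` (`planar_inner_lt_half`), i.e. `cos (θ − θ') < 1/2` in
polar form `θ = arg (X + iY)` (numerically the largest planar cosine of two lens points at
`ℓ = 1.13 d`, `ρ = 1.14 d` is `≈ 0.490`; six points fit in the lens iff `ℓ ≤ 1.092 d`).  Six lens
points would give six distinct directions; sorted, their five consecutive gaps and the wrap-around
gap are each `> π/3` and sum to `2π` — contradiction
(`Literature.Geometry.DiscreteGeometry.six_sorted_angles_false`, the Musin–Tarasov degree-five
pattern of `SphericalCodeContactGraph.lean`).  The coordinate statement is
`card_le_five_of_lens_coords` (any finite index type); the main theorem feeds it the frame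
coordinates of the points of `S`.  No interval arithmetic is needed.
-/

noncomputable section

namespace Summit.AtomisticToContinuum.Crystallization.Theorems.ParFiveRecountLensPin

open Real RealInnerProductSpace Literature.Geometry.DiscreteGeometry
  Summit.AtomisticToContinuum.Crystallization.Theorems.ParFiveRecountLensSix

/-! ### The strict planar angle bound for a long pair -/

/-- **Two lens points of a long pair: planar cosine `< 1/2`.** In the bounds of
`ParFiveRecountLensSix.lens_point_bounds` (planar radii `r, r' ≥ 0` with `r² = u`, `r'² = u'`,
mid-plane heights `h, h'`, `u + 5h² ≤ ρ² − ℓ²/4`, `d² − ℓ²/4 ≤ u`), if moreover the pair is long,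
`(113/100) d ≤ ℓ ≤ ρ ≤ (57/50) d`, and the two points are at distance `≥ d`, i.e.
`d² ≤ u + u' − 2P + (h − h')²` for the planar inner product `P`, then `2P < r r'`.
Indeed `r r' ≥ L := d² − ℓ²/4`, so `(r + r')² ≥ 4L ≥ (4 − 3249/2500) d²` and
`(r − r')² ≤ (u − u')² / (r + r')² ≤ (ρ² − d²)² / (4L) ≤ (7/200) d²`; then
`2P ≤ u + u' + (h − h')² − d² ≤ 2 (ρ² − ℓ²/4) − d² − (h² + h'²) < u + u' − (r − r')² = 2 r r'`
because `ρ² − ℓ²/4 + (7/400) d² ≤ (39915/40000) d² < d²`. [folklore] -/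
theorem planar_inner_lt_half {d ℓ ρ u u' h h' P r r' : ℝ} (hd : 0 < d)
    (hdl : 113 / 100 * d ≤ ℓ) (hlρ : ℓ ≤ ρ) (hρ : ρ ≤ 57 / 50 * d) (hr : 0 ≤ r) (hru : r ^ 2 = u)
    (hr' : 0 ≤ r') (hru' : r' ^ 2 = u') (hp : u + 5 * h ^ 2 ≤ ρ ^ 2 - ℓ ^ 2 / 4)
    (hlo : d ^ 2 - ℓ ^ 2 / 4 ≤ u) (hp' : u' + 5 * h' ^ 2 ≤ ρ ^ 2 - ℓ ^ 2 / 4)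
    (hlo' : d ^ 2 - ℓ ^ 2 / 4 ≤ u') (hsep : d ^ 2 ≤ u + u' - 2 * P + (h - h') ^ 2) :
    2 * P < r * r' := by
  have hρ2 : ρ ^ 2 ≤ 3249 / 2500 * d ^ 2 := by
    nlinarith [mul_nonneg (sub_nonneg.2 hρ) (by linarith : 0 ≤ 57 / 50 * d + ρ)]
  have hℓlo : 12769 / 10000 * d ^ 2 ≤ ℓ ^ 2 := by
    nlinarith [mul_nonneg (sub_nonneg.2 hdl) (by linarith : 0 ≤ 113 / 100 * d + ℓ)]
  have hℓ2 : ℓ ^ 2 ≤ ρ ^ 2 := pow_le_pow_left₀ (by linarith) hlρ 2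
  have hd2 : 0 < d ^ 2 := pow_pos hd 2
  have hd4 : 0 < d ^ 4 := pow_pos hd 4
  have hL : 0 < d ^ 2 - ℓ ^ 2 / 4 := by linarith
  -- the product of the planar radii is at least `L = d² − ℓ²/4`
  have hrr : d ^ 2 - ℓ ^ 2 / 4 ≤ r * r' := by
    have h1 : (d ^ 2 - ℓ ^ 2 / 4) ^ 2 ≤ (r * r') ^ 2 := by
      rw [mul_pow, hru, hru', sq]
      exact mul_le_mul hlo hlo' hL.le (hL.le.trans hlo)
    exact (pow_le_pow_iff_left₀ hL.le (mul_nonneg hr hr') two_ne_zero).1 h1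
  -- the two planar radii are close: `(r - r')² ≤ (7/200) d²`
  have hdiff : (r - r') ^ 2 ≤ 7 / 200 * d ^ 2 := by
    have hprod : (r - r') ^ 2 * (r + r') ^ 2 = (u - u') ^ 2 := by rw [← hru, ← hru']; ring
    have hsum : 4 * (d ^ 2 - ℓ ^ 2 / 4) ≤ (r + r') ^ 2 := by linarith [hrr, hru, hru', hlo, hlo']
    have e1 : u - u' ≤ ρ ^ 2 - d ^ 2 := by linarith [sq_nonneg h]
    have e2 : u' - u ≤ ρ ^ 2 - d ^ 2 := by linarith [sq_nonneg h']
    have huu : (u - u') ^ 2 ≤ (ρ ^ 2 - d ^ 2) ^ 2 := sq_le_sq' (by linarith) e1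
    have hρd : ρ ^ 2 - d ^ 2 ≤ 749 / 2500 * d ^ 2 := by linarith
    have hρd' : 0 ≤ ρ ^ 2 - d ^ 2 := by linarith
    have hsq : (ρ ^ 2 - d ^ 2) ^ 2 ≤ (749 / 2500 * d ^ 2) ^ 2 := pow_le_pow_left₀ hρd' hρd 2
    by_contra hc
    have hc' := not_le.1 hc
    have hpos : 0 < (r + r') ^ 2 := by linarith
    have key : 7 / 200 * d ^ 2 * (4 * (d ^ 2 - ℓ ^ 2 / 4)) < (u - u') ^ 2 :=
      calc 7 / 200 * d ^ 2 * (4 * (d ^ 2 - ℓ ^ 2 / 4)) ≤ 7 / 200 * d ^ 2 * (r + r') ^ 2 :=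
            mul_le_mul_of_nonneg_left hsum (by positivity)
        _ < (r - r') ^ 2 * (r + r') ^ 2 := mul_lt_mul_of_pos_right hc' hpos
        _ = (u - u') ^ 2 := hprod
    linarith [key, huu, hsq, hd4, mul_le_mul_of_nonneg_left (hℓ2.trans hρ2) hd2.le]
  -- the main estimate
  have key2 : 2 * (r * r') = u + u' - (r - r') ^ 2 := by rw [← hru, ← hru']; ring
  linarith [hsep, hp, hp', sq_nonneg (h + h'), sq_nonneg h, sq_nonneg h', key2, hdiff, hρ2,
    hℓlo, hd2]

/-! ### Lens points in coordinates: at most five -/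

/-- **At most five lens points (coordinate form).** With `x = 0`, `y = (0, 0, ℓ)`,
`(113/100) d ≤ ℓ ≤ ρ ≤ (57/50) d`, `0 < d`, a finite family of points `(Xᵢ, Yᵢ, Hᵢ)` with
`d ≤ |z x|, |z y| ≤ ρ` and pairwise distances `≥ d` has at most five members: in polar form
`θᵢ = arg (Xᵢ + i Yᵢ)` (radii `> 0` by `lens_point_bounds`) any two directions satisfy
`cos (θᵢ − θₖ) < 1/2` (`planar_inner_lt_half`), so the `θᵢ` are distinct, and six of them, sorted,
contradict `six_sorted_angles_false`. [folklore] -/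
theorem card_le_five_of_lens_coords {d ℓ ρ : ℝ} (hd : 0 < d) (hdl : 113 / 100 * d ≤ ℓ)
    (hlρ : ℓ ≤ ρ) (hρ : ρ ≤ 57 / 50 * d) {ι : Type*} [Fintype ι] (X Y H : ι → ℝ)
    (hx1 : ∀ i, d ^ 2 ≤ X i ^ 2 + Y i ^ 2 + H i ^ 2)
    (hx2 : ∀ i, X i ^ 2 + Y i ^ 2 + H i ^ 2 ≤ ρ ^ 2)
    (hy1 : ∀ i, d ^ 2 ≤ X i ^ 2 + Y i ^ 2 + (H i - ℓ) ^ 2)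
    (hy2 : ∀ i, X i ^ 2 + Y i ^ 2 + (H i - ℓ) ^ 2 ≤ ρ ^ 2)
    (hsep : ∀ i k, i ≠ k → d ^ 2 ≤ (X i - X k) ^ 2 + (Y i - Y k) ^ 2 + (H i - H k) ^ 2) :
    Fintype.card ι ≤ 5 := by
  classical
  have hdl' : d ≤ ℓ := by linarith
  set r : ι → ℝ := fun i => ‖(⟨X i, Y i⟩ : ℂ)‖ with hrdef
  set θ : ι → ℝ := fun i => Complex.arg ⟨X i, Y i⟩ with hθdef
  have hrsq : ∀ i, r i ^ 2 = X i ^ 2 + Y i ^ 2 := by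
    intro i
    simp only [hrdef, Complex.sq_norm, Complex.normSq_mk]
    ring
  have hr0 : ∀ i, 0 ≤ r i := fun i => norm_nonneg _
  have hpt : ∀ i, X i ^ 2 + Y i ^ 2 + 5 * (H i - ℓ / 2) ^ 2 ≤ ρ ^ 2 - ℓ ^ 2 / 4 ∧
      d ^ 2 - ℓ ^ 2 / 4 ≤ X i ^ 2 + Y i ^ 2 :=
    fun i => lens_point_bounds hd hdl' hlρ hρ (hx1 i) (hx2 i) (hy1 i) (hy2 i)
  have hρ2 : ρ ^ 2 ≤ 3249 / 2500 * d ^ 2 := by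
    nlinarith [mul_nonneg (sub_nonneg.2 hρ) (by linarith : 0 ≤ 57 / 50 * d + ρ)]
  have hℓ2 : ℓ ^ 2 ≤ ρ ^ 2 := pow_le_pow_left₀ (by linarith) hlρ 2
  have hrpos : ∀ i, 0 < r i := by
    intro i
    have h2 : 0 < r i ^ 2 := by rw [hrsq]; linarith [(hpt i).2, pow_pos hd 2]
    rcases (hr0 i).lt_or_eq with h | h
    · exact h
    · rw [← h] at h2; norm_num at h2
  have hX : ∀ i, X i = r i * cos (θ i) := fun i => (Complex.norm_mul_cos_arg ⟨X i, Y i⟩).symm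
  have hY : ∀ i, Y i = r i * sin (θ i) := fun i => (Complex.norm_mul_sin_arg ⟨X i, Y i⟩).symm
  -- the pairwise constraints: `cos (θ i - θ k) < 1/2`
  have hcos : ∀ i k, i ≠ k → cos (θ i - θ k) < 1 / 2 := by
    intro i k hik
    have hdot : X i * X k + Y i * Y k = r i * r k * cos (θ i - θ k) := by
      rw [hX i, hX k, hY i, hY k, cos_sub]; ring
    have hs : d ^ 2 ≤ (X i ^ 2 + Y i ^ 2) + (X k ^ 2 + Y k ^ 2) - 2 * (X i * X k + Y i * Y k)
        + ((H i - ℓ / 2) - (H k - ℓ / 2)) ^ 2 := by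
      linarith [hsep i k hik]
    have hlt : 2 * (X i * X k + Y i * Y k) < r i * r k :=
      planar_inner_lt_half hd hdl hlρ hρ (hr0 i) (hrsq i) (hr0 k) (hrsq k) (hpt i).1 (hpt i).2
        (hpt k).1 (hpt k).2 hs
    rw [hdot] at hlt
    have hpos : 0 < r i * r k := mul_pos (hrpos i) (hrpos k)
    by_contra hc
    have := mul_le_mul_of_nonneg_left (not_lt.1 hc) hpos.le
    linarith
  have hθinj : Function.Injective θ := by
    intro i k hik
    by_contra hne
    have := hcos i k hne
    rw [hik, sub_self, cos_zero] at this
    norm_num at this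
  -- six of the (distinct) directions, sorted
  by_contra hcard
  obtain ⟨T, hT, hTcard⟩ := Finset.exists_subset_card_eq
    (show 6 ≤ (Finset.univ.image θ).card by
      rw [Finset.card_image_of_injective _ hθinj, Finset.card_univ]; omega)
  let e := T.orderEmbOfFin hTcard
  have hmem : ∀ k, ∃ i, θ i = e k := by
    intro k
    have := hT (T.orderEmbOfFin_mem hTcard k)
    rw [Finset.mem_image] at this
    obtain ⟨i, -, hi⟩ := this
    exact ⟨i, hi⟩
  choose π' hπ' using hmem
  refine six_sorted_angles_false (fun k => e k) e.strictMono ?_ ?_ ?_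
  · show -π < e 0
    rw [← hπ' 0]
    exact Complex.neg_pi_lt_arg _
  · show e 5 ≤ π
    rw [← hπ' 5]
    exact Complex.arg_le_pi _
  · intro i j hij
    have hne : π' i ≠ π' j := by
      intro h
      apply hij
      apply e.injective
      rw [← hπ' i, ← hπ' j, h]
    rw [← hπ' i, ← hπ' j]
    exact hcos _ _ hne

/-! ### The geometric statement -/

/-- **Lens capacity five for a long pair** (stub `stub_lensPinning` of line `Sketch`, crux
`SquareWellLayerCake.AveragedTwelve`).  For `0 < d`, `ρ ≤ (57/50) d` and a long near pair `x, y`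
(`(113/100) d ≤ |xy| ≤ ρ`), every finite `d`-separated set of points within `[d, ρ]` of both `x`
and `y` has at most five elements: take coordinates in a frame with third vector `(y − x)/|xy|`
(`ParFiveRecountLensSix.exists_frame`) and apply `card_le_five_of_lens_coords` to the points of
`S`. [folklore] -/
theorem stub_lensPinning : ∀ (d ρ : ℝ), 0 < d → ρ ≤ 57 / 50 * d → ∀ (x y : EuclideanSpace ℝ (Fin 3)), 113 / 100 * d ≤ dist x y → dist x y ≤ ρ → ∀ (S : Finset (EuclideanSpace ℝ (Fin 3))), (∀ z ∈ S, d ≤ dist z x ∧ dist z x ≤ ρ ∧ d ≤ dist z y ∧ dist z y ≤ ρ) → (∀ z ∈ S, ∀ w ∈ S, z ≠ w → d ≤ dist z w) → S.card ≤ 5 := by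
  intro d ρ hd hρ x y hxy hxy' S hS hsep
  set ℓ := dist x y with hℓdef
  have hℓ : 0 < ℓ := by linarith
  have hyx : ‖y - x‖ = ℓ := by rw [← dist_eq_norm, dist_comm]
  obtain ⟨n, hn, hyxn⟩ : ∃ n : EuclideanSpace ℝ (Fin 3), ‖n‖ = 1 ∧ y - x = ℓ • n :=
    ⟨ℓ⁻¹ • (y - x), by
      rw [norm_smul, norm_inv, Real.norm_eq_abs, abs_of_pos hℓ, hyx, inv_mul_cancel₀ hℓ.ne'],
      by rw [smul_smul, mul_inv_cancel₀ hℓ.ne', one_smul]⟩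
  obtain ⟨b, hb0, hb1, hnorm, hdiff⟩ := exists_frame hn
  have hX0 : ⟪b 0, y - x⟫ = 0 := by rw [hyxn, real_inner_smul_right, hb0, mul_zero]
  have hY0 : ⟪b 1, y - x⟫ = 0 := by rw [hyxn, real_inner_smul_right, hb1, mul_zero]
  have hH0 : ⟪y - x, n⟫ = ℓ := by
    rw [hyxn, real_inner_smul_left, real_inner_self_eq_norm_sq, hn]; ring
  have hdx : ∀ z : EuclideanSpace ℝ (Fin 3), dist z x ^ 2
      = ⟪b 0, z - x⟫ ^ 2 + ⟪b 1, z - x⟫ ^ 2 + ⟪z - x, n⟫ ^ 2 := fun z => by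
    rw [dist_eq_norm]; exact hnorm _
  have hdy : ∀ z : EuclideanSpace ℝ (Fin 3), dist z y ^ 2
      = ⟪b 0, z - x⟫ ^ 2 + ⟪b 1, z - x⟫ ^ 2 + (⟪z - x, n⟫ - ℓ) ^ 2 := fun z => by
    rw [dist_eq_norm, ← sub_sub_sub_cancel_right z y x, hdiff, hX0, hY0, hH0, sub_zero,
      sub_zero]
  have hdd : ∀ z w : EuclideanSpace ℝ (Fin 3), dist z w ^ 2 = (⟪b 0, z - x⟫ - ⟪b 0, w - x⟫) ^ 2
      + (⟪b 1, z - x⟫ - ⟪b 1, w - x⟫) ^ 2 + (⟪z - x, n⟫ - ⟪w - x, n⟫) ^ 2 := fun z w => by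
    rw [dist_eq_norm, ← sub_sub_sub_cancel_right z w x, hdiff]
  refine (Fintype.card_coe S).symm.trans_le
    (card_le_five_of_lens_coords hd hxy hxy' hρ
      (fun z : S => ⟪b 0, (z : EuclideanSpace ℝ (Fin 3)) - x⟫)
      (fun z : S => ⟪b 1, (z : EuclideanSpace ℝ (Fin 3)) - x⟫)
      (fun z : S => ⟪(z : EuclideanSpace ℝ (Fin 3)) - x, n⟫) ?_ ?_ ?_ ?_ ?_)
  · intro z; rw [← hdx]; exact pow_le_pow_left₀ hd.le (hS z z.2).1 2
  · intro z; rw [← hdx]; exact pow_le_pow_left₀ dist_nonneg (hS z z.2).2.1 2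
  · intro z; rw [← hdy]; exact pow_le_pow_left₀ hd.le (hS z z.2).2.2.1 2
  · intro z; rw [← hdy]; exact pow_le_pow_left₀ dist_nonneg (hS z z.2).2.2.2 2
  · intro z w hzw; rw [← hdd]
    exact pow_le_pow_left₀ hd.le (hsep z z.2 w w.2 fun h => hzw (Subtype.ext h)) 2

end Summit.AtomisticToContinuum.Crystallization.Theorems.ParFiveRecountLensPin

end
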